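import Mathlib.Algebra.Polynomial.Derivative
import Mathlib.Algebra.Polynomial.FieldDivision
import Mathlib.RingTheory.EuclideanDomain
import HarnessLib

/-!
# x-map certificates of isogenies between short Weierstrass curves

Topic `Literature/NumberTheory/EllipticCurves`. A deliberately LIGHT module (Mathlib polynomial
algebra only; it must not import the isogeny prelude
`Literature.NumberTheory.EllipticCurves.Isogeny`) providing the predicate requested by route
`IsogenyCertificates` (summit KontsevichZagierPeriods, definition item `defn-HasXMapCertificate`).

## The notion

Let `K` be a field and `E : y² = P(x) = x³ + Ax + B`, `E' : y'² = P'(x') = x'³ + A'x' + B'` short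
Weierstrass cubics over `K`. A homomorphism `φ : E → E'` given by rational functions has the
*standard form* `φ(x, y) = (R(x), y · S(x))` with `R = f/g`, `S ∈ K(x)` (Washington, *Elliptic
Curves* (2008), §2.9, for endomorphisms; the same computation for isogenies), and it pulls the
invariant differential back to a constant multiple, `φ^*(dx'/y') = u · dx/y` (Washington 2008,
Remark 2.26; Silverman, *The Arithmetic of Elliptic Curves* (2009), proof of Cor. III.5.6: `φ^*ω`
is `a_φ ω` with `a_φ` constant), with `u ≠ 0` iff `φ` is separable (always, in characteristic
`0`); whence `S = R'/u` and, squaring the second coordinate on the curve, the polynomial identity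

  `P(x) · R'(x)² = u² · P'(R(x))`, i.e. with `R = f/g`, `w := f'g − fg'` (so `R' = w/g²`):
  `(X³ + A X + B) · w² = u² · g · (f³ + A' f g² + B' g³)`.

`Literature.NumberTheory.EllipticCurves.HasXMapCertificate A B A' B'` records exactly the existence
of such a triple `(f, g, u)` with `g ≠ 0`, `u ≠ 0` and `w ≠ 0` (`R` non-constant) — an
**x-map certificate**. It is a purely algebraic, first-order condition on `(A, B, A', B')`, which
is the point: statements about "all `K`-isogenies between short Weierstrass curves" can be phrased
over Mathlib's `Polynomial` alone.

## Contents (all proved; no named facts)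

* `HasXMapCertificate` and its unfolding `hasXMapCertificate_iff`;
* `xMapWronskian f g = f'g − fg'` with `xMapWronskian_mul_mul` (`w(hf, hg) = h² · w(f, g)`) and
  the cancellation lemma `xMapIdentity_cancel` (a common factor `h ≠ 0` of `f`, `g` can be removed
  from the identity), whence `HasXMapCertificate.exists_isCoprime` (every certificate can be taken
  in lowest terms);
* `HasXMapCertificate.refl` — the identity certificate `(f, g, u) = (X, 1, 1)`;
* `certificateDegree f g = max (deg f) (deg g)` — for coprime `(f, g)` the degree of the rational
  function `f/g`, Washington's *definition* of the degree of the endomorphism/isogeny in standard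
  form (Washington 2008, §2.9: "deg(α) = Max{deg p(x), deg q(x)}"); recorded here only as a
  definition;
* `hasXMapCertificate_lemniscate` — the worked example `K = ℚ`, `(A, B, A', B') = (−1, 0, 4, 0)`,
  `(f, g, u) = (X² − 1, X, 1)`: the `2`-isogeny `y² = x³ − x → y² = x³ + 4x`,
  `x ↦ x − 1/x` (Silverman 2009, III.4.5 with `(a, b) = (0, −1)`), checked by `ring`.

## What is *not* here

The BRIDGE with the tree's isogenies — for elliptic curves in short Weierstrass form over a field
of characteristic `0`, `WeierstrassCurve.IsIsogenous ⟨0,0,0,A,B⟩ ⟨0,0,0,A',B'⟩ ↔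
HasXMapCertificate A B A' B'`, with isogeny degree `= certificateDegree` of a coprime certificate
(⇒: standard form and invariant differential, Washington §2.9, Silverman III.5; ⇐: a non-constant
rational map is a morphism, hence a translate of an isogeny, Silverman II.2.1, III.4.7) — belongs
to a heavier `…Proofs` module importing the isogeny prelude and is not stated in this light file.

## References

* L. C. Washington, *Elliptic Curves: Number Theory and Cryptography*, 2nd ed. (2008), §2.9
  (standard form `(r₁(x), r₂(x)y)`, `deg = Max{deg p, deg q}`, separability iff `r₁' ≠ 0`,
  Lemma 2.23, Remark 2.26: `(dx/y) ∘ α = c_α dx/y`). [Washington2008]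
* J. H. Silverman, *The Arithmetic of Elliptic Curves*, 2nd ed., GTM 106 (2009), Example III.4.5
  (the `2`-isogenies `y² = x³ + ax² + bx → Y² = X³ − 2aX² + (a² − 4b)X`), III.5 (invariant
  differential; proof of Cor. III.5.6: `φ^*ω = a_φ ω`, `a_φ` constant). [SilvermanAEC2009]
-/

open Polynomial

namespace Literature.NumberTheory.EllipticCurves

variable {K : Type*} [Field K]

/-! ### The Wronskian numerator of `(f/g)'` -/

/-- The numerator `w = f'g − fg'` of the derivative of the rational function `R = f/g`
(`R' = w/g²`). [folklore] -/
noncomputable def xMapWronskian (f g : K[X]) : K[X] :=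
  derivative f * g - f * derivative g

/-- Unfolding lemma for `xMapWronskian`. [folklore] -/
theorem xMapWronskian_def (f g : K[X]) :
    xMapWronskian f g = derivative f * g - f * derivative g :=
  rfl

/-- Scaling numerator and denominator by a common factor `h` multiplies the Wronskian by `h²`:
`(hf)'(hg) − (hf)(hg)' = h² (f'g − fg')` (the `h h'` cross terms cancel). [folklore] -/
theorem xMapWronskian_mul_mul (h f g : K[X]) :
    xMapWronskian (h * f) (h * g) = h ^ 2 * xMapWronskian f g := by
  simp only [xMapWronskian, derivative_mul]
  ring

/-- The Wronskian of the identity map `R = X/1` is `1`. [folklore] -/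
@[simp] theorem xMapWronskian_X_one : xMapWronskian (X : K[X]) 1 = 1 := by
  simp [xMapWronskian]

/-! ### x-map certificates -/

/-- **x-map certificate of an isogeny between short Weierstrass curves.** For `A B A' B' : K`
(the curves `y² = X³ + AX + B` and `y² = X³ + A'X + B'`), `HasXMapCertificate A B A' B'` says:
there are polynomials `f, g ∈ K[X]` and a scalar `u ∈ K` with `g ≠ 0`, `u ≠ 0`,
`w := f'g − fg' ≠ 0` (i.e. `R = f/g` is a non-constant rational function) and

  `(X³ + A X + B) · w² = u² · g · (f³ + A' f g² + B' g³)`,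

which is the identity `P · (R')² = u² · (P' ∘ R)` cleared of denominators — the condition that
`φ(x, y) = (R(x), y · R'(x)/u)` maps the first curve to the second, `u` being the scalar of the
invariant differential, `φ^*(dx'/y') = u · dx/y` (Washington, *Elliptic Curves* (2008), §2.9:
standard form `(r₁(x), r₂(x)y)` of a homomorphism given by rational functions, Remark 2.26:
`(dx/y) ∘ α = c_α · dx/y`, so `r₂ = r₁'/c_α` and `P r₂² = P' ∘ r₁` on the curve; Silverman 2009,
proof of Cor. III.5.6). The Wronskian is written out (`derivative f * g - f * derivative g`, cf.
`xMapWronskian`) so that the predicate unfolds to Mathlib primitives only.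
[cite: Washington2008, §2.9 (standard form; Remark 2.26)] -/
def HasXMapCertificate (A B A' B' : K) : Prop :=
  ∃ f g : K[X], ∃ u : K, g ≠ 0 ∧ u ≠ 0 ∧ derivative f * g - f * derivative g ≠ 0 ∧
    (X ^ 3 + C A * X + C B) * (derivative f * g - f * derivative g) ^ 2 =
      C (u ^ 2) * g * (f ^ 3 + C A' * f * g ^ 2 + C B' * g ^ 3)

variable {A B A' B' : K}

/-- Unfolding lemma for `HasXMapCertificate`, in terms of `xMapWronskian`.
[cite: Washington2008, §2.9] -/
theorem hasXMapCertificate_iff :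
    HasXMapCertificate A B A' B' ↔
      ∃ f g : K[X], ∃ u : K, g ≠ 0 ∧ u ≠ 0 ∧ xMapWronskian f g ≠ 0 ∧
        (X ^ 3 + C A * X + C B) * xMapWronskian f g ^ 2 =
          C (u ^ 2) * g * (f ^ 3 + C A' * f * g ^ 2 + C B' * g ^ 3) :=
  Iff.rfl

/-- **Cancelling a common factor.** If the certificate identity holds for `(hf, hg, u)` with
`h ≠ 0`, it holds for `(f, g, u)`: both sides acquire the factor `h⁴` (`w(hf, hg) = h² w(f, g)`,
`xMapWronskian_mul_mul`), which cancels in the domain `K[X]`. [folklore] -/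
theorem xMapIdentity_cancel {f g h : K[X]} {u : K} (hh : h ≠ 0)
    (H : (X ^ 3 + C A * X + C B) * xMapWronskian (h * f) (h * g) ^ 2 =
      C (u ^ 2) * (h * g) * ((h * f) ^ 3 + C A' * (h * f) * (h * g) ^ 2 + C B' * (h * g) ^ 3)) :
    (X ^ 3 + C A * X + C B) * xMapWronskian f g ^ 2 =
      C (u ^ 2) * g * (f ^ 3 + C A' * f * g ^ 2 + C B' * g ^ 3) := by
  rw [xMapWronskian_mul_mul] at H
  refine mul_left_cancel₀ (pow_ne_zero 4 hh) ?_
  calc h ^ 4 * ((X ^ 3 + C A * X + C B) * xMapWronskian f g ^ 2)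
      = (X ^ 3 + C A * X + C B) * (h ^ 2 * xMapWronskian f g) ^ 2 := by ring
    _ = C (u ^ 2) * (h * g) * ((h * f) ^ 3 + C A' * (h * f) * (h * g) ^ 2 + C B' * (h * g) ^ 3) := H
    _ = h ^ 4 * (C (u ^ 2) * g * (f ^ 3 + C A' * f * g ^ 2 + C B' * g ^ 3)) := by ring

/-- **Certificates may be taken in lowest terms**: dividing `f` and `g` by their gcd (`K[X]` is a
Euclidean domain) yields a certificate with `IsCoprime f g`, by `xMapIdentity_cancel`. [folklore] -/
theorem HasXMapCertificate.exists_isCoprime (hc : HasXMapCertificate A B A' B') :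
    ∃ f g : K[X], ∃ u : K, IsCoprime f g ∧ g ≠ 0 ∧ u ≠ 0 ∧ xMapWronskian f g ≠ 0 ∧
      (X ^ 3 + C A * X + C B) * xMapWronskian f g ^ 2 =
        C (u ^ 2) * g * (f ^ 3 + C A' * f * g ^ 2 + C B' * g ^ 3) := by
  classical
  letI := EuclideanDomain.gcdMonoid K[X]
  obtain ⟨f, g, u, hg, hu, hw, H⟩ := hc
  have hd : GCDMonoid.gcd f g ≠ 0 := gcd_ne_zero_of_right hg
  have hcop := isCoprime_div_gcd_div_gcd (p := f) hg
  obtain ⟨f₁, hf⟩ := GCDMonoid.gcd_dvd_left f g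
  obtain ⟨g₁, hg₁⟩ := GCDMonoid.gcd_dvd_right f g
  generalize GCDMonoid.gcd f g = d at hd hcop hf hg₁
  subst hf hg₁
  rw [mul_div_cancel_left₀ f₁ hd, mul_div_cancel_left₀ g₁ hd] at hcop
  have hw₁ : xMapWronskian (d * f₁) (d * g₁) ≠ 0 := hw
  have H₁ : (X ^ 3 + C A * X + C B) * xMapWronskian (d * f₁) (d * g₁) ^ 2 =
      C (u ^ 2) * (d * g₁) * ((d * f₁) ^ 3 + C A' * (d * f₁) * (d * g₁) ^ 2 +
        C B' * (d * g₁) ^ 3) := H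
  rw [xMapWronskian_mul_mul] at hw₁
  exact ⟨f₁, g₁, u, hcop, right_ne_zero_of_mul hg, hu, right_ne_zero_of_mul hw₁,
    xMapIdentity_cancel hd H₁⟩

/-- **The identity certificate**: `(f, g, u) = (X, 1, 1)` certifies `(A, B) ~ (A, B)` (the
identity isogeny, `R = x`, `u = 1`). [folklore] -/
theorem HasXMapCertificate.refl (A B : K) : HasXMapCertificate A B A B := by
  refine ⟨X, 1, 1, one_ne_zero, one_ne_zero, ?_, ?_⟩
  · simp
  · simp only [derivative_X, derivative_one, mul_one, mul_zero, sub_zero, one_pow, map_one]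
    ring

/-- A certificate is in particular inhabited data: extract some triple. [folklore] -/
theorem HasXMapCertificate.exists (hc : HasXMapCertificate A B A' B') :
    ∃ f g : K[X], g ≠ 0 ∧ xMapWronskian f g ≠ 0 :=
  let ⟨f, g, _, hg, _, hw, _⟩ := hc
  ⟨f, g, hg, hw⟩

/-! ### The degree of a certificate -/

/-- The **degree** of an x-map certificate `(f, g, u)`: `max (deg f) (deg g)`, the degree of the
rational function `R = f/g` when `f`, `g` are coprime (`HasXMapCertificate.exists_isCoprime`),
which is Washington's definition of the degree of the map `(x, y) ↦ (R(x), y R'(x)/u)` in standard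
form (*Elliptic Curves* (2008), §2.9: "deg(α) = Max{deg p(x), deg q(x)}" for `r₁ = p/q` in lowest
terms). Recorded as a definition only; no claim relating it to Mathlib/tree isogeny degrees is made
in this file. [cite: Washington2008, §2.9 (definition of deg α)] -/
def certificateDegree (f g : K[X]) : ℕ :=
  max f.natDegree g.natDegree

/-- Unfolding lemma for `certificateDegree`. [folklore] -/
theorem certificateDegree_def (f g : K[X]) :
    certificateDegree f g = max f.natDegree g.natDegree :=
  rfl

/-- The identity certificate `(X, 1)` has degree `1`. [folklore] -/
@[simp] theorem certificateDegree_X_one : certificateDegree (X : K[X]) 1 = 1 := by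
  simp [certificateDegree]

/-- `certificateDegree` is symmetric in `f`, `g` (`R` and `1/R` have the same degree). [folklore] -/
theorem certificateDegree_comm (f g : K[X]) : certificateDegree f g = certificateDegree g f :=
  max_comm _ _

/-! ### The lemniscate example -/

/-- **The lemniscate `2`-isogeny as a certificate.** Over `K = ℚ`, `(A, B, A', B') = (−1, 0, 4, 0)`:
the curves `y² = x³ − x` and `y² = x³ + 4x` are `2`-isogenous by `x ↦ x − 1/x = (x² − 1)/x`
(Silverman, *The Arithmetic of Elliptic Curves* (2009), Example III.4.5 with `(a, b) = (0, −1)`: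
`y² = x³ + ax² + bx → Y² = X³ − 2aX² + (a² − 4b)X`, `X = y²/x²`), and `(f, g, u) = (X² − 1, X, 1)`
is an x-map certificate: `w = 2X·X − (X² − 1) = X² + 1` and
`(X³ − X)(X² + 1)² = X · ((X² − 1)³ + 4 (X² − 1) X²)`, an identity of integer polynomials checked
by `ring`. Its `certificateDegree` is `2`. [cite: SilvermanAEC2009, Example III.4.5] -/
theorem hasXMapCertificate_lemniscate : HasXMapCertificate (-1 : ℚ) 0 4 0 := by
  refine ⟨X ^ 2 - 1, X, 1, X_ne_zero, one_ne_zero, ?_, ?_⟩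
  · -- `w = X² + 1 ≠ 0`: its constant coefficient is `1`
    have hw : derivative (X ^ 2 - 1 : ℚ[X]) * X - (X ^ 2 - 1) * derivative X = X ^ 2 + 1 := by
      simp only [derivative_sub, derivative_X_pow, derivative_one, derivative_X, Nat.cast_ofNat,
        map_ofNat, Nat.add_one_sub_one, pow_one]
      ring
    rw [hw]
    intro h0
    have := congrArg (fun p : ℚ[X] ↦ p.coeff 0) h0
    simp at this
  · simp only [derivative_sub, derivative_X_pow, derivative_one, derivative_X, Nat.cast_ofNat,
      map_ofNat, Nat.add_one_sub_one, pow_one, map_neg, map_one, map_zero, one_pow]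
    ring

/-- The lemniscate certificate `(X² − 1, X)` has degree `2` (a `2`-isogeny).
[cite: SilvermanAEC2009, Example III.4.5] -/
theorem certificateDegree_lemniscate : certificateDegree (X ^ 2 - 1 : ℚ[X]) X = 2 := by
  rw [certificateDegree, natDegree_X, natDegree_sub_eq_left_of_natDegree_lt] <;> simp

end Literature.NumberTheory.EllipticCurves
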